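import Literature.AlgebraicGeometry.Motives.EllAdicTowerGalois
import Literature.AlgebraicGeometry.Motives.Comparison
import HarnessLib

/-!
# `H•(X_ét, ℚ_ℓ) := ℚ_ℓ ⊗_{ℤ_ℓ} lim_m H•(X_ét, ℤ/ℓᵐ)`: a functor to graded `ℚ_ℓ`-algebras with Galois action

Base change to `ℚ_ℓ` of the `ℓ`-adic tower of `R`-linear étale cohomology rings
(`EllAdicTowerFunctor.lean`, `EllAdicTowerGalois.lean`), after the pattern of the tree's
`EllAdicEtaleRational.lean` (which did this for Mathlib's `Ab`-valued groups, without products):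

* `etaleEllAdicRat Y ℓ n = ℚ_ℓ ⊗_{ℤ_ℓ} lim_m Hⁿ(Y_ét, ℤ/ℓᵐ)` (Milne V §1: `Hʳ(X, ℚ_l) = Hʳ(X, ℤ_l) ⊗ ℚ_l`;
  Deligne, Weil I (1.3)), the pull-back `etaleEllAdicRatMap f ℓ n` (`LinearMap.baseChange`) with
  `_comp`, `_id`;
* the **cup product** `etaleEllAdicRat.cup h` (the `ℚ_ℓ`-bilinear extension `baseChangeBilin` of the
  `ℤ_ℓ`-bilinear `cupBilin`, `(a ⊗ x) ∪ (b ⊗ y) = ab ⊗ (x ∪ y)`) and unit `one`, with `one_cup`,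
  `cup_one`, `cup_assoc`, and `etaleEllAdicRatMap_cup/_one` (pull-backs are unital ring maps);
* the Galois representation `geometricEllAdicRatRep X ℓ n : Representation ℚ_ℓ Gal(k̄/k) (Hⁿ(X_{k̄}, ℚ_ℓ))`
  (base change of `geometricEllAdicTowerRep`), multiplicative (`_cup`), equivariance of pull-backs
  (`_pullback`), and **`F^* = ρ(F_geom)`** (`etaleEllAdicRatMap_frobenius_eq_geomFrob`, Deligne (1.15.1)).

Everything is proved; no named facts.

## References

* P. Deligne, *La conjecture de Weil. I*, Publ. Math. IHÉS 43 (1974), (1.1), (1.3), (1.15). [Deligne1974]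
* J. S. Milne, *Étale cohomology* (reissue 2025; held copy): V §1 (p. 176), V Prop. 1.16.
  [Milne2025]
-/

universe u

open CategoryTheory CategoryTheory.Limits AlgebraicGeometry Opposite
open scoped TensorProduct

namespace Literature.AlgebraicGeometry.Motives

-- The level types `Hⁿ(X_ét, ℤ/ℓᵐ) = Extⁿ(…)` are large terms; instance synthesis through
-- `ℚ_ℓ ⊗[ℤ_ℓ] lim_m (…)` needs more room than the defaults.
set_option synthInstance.maxHeartbeats 400000
set_option maxHeartbeats 1600000

/-! ### The `ℚ_ℓ`-cohomology and its pull-backs -/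

section Rat

variable {X Y Z : Scheme.{u}} (f : X ⟶ Y) (g : Y ⟶ Z) (ℓ : ℕ) [Fact ℓ.Prime]

/-- **`Hⁿ(Y_ét, ℚ_ℓ) := ℚ_ℓ ⊗_{ℤ_ℓ} lim_m Hⁿ(Y_ét, ℤ/ℓᵐ)`** (Milne V §1; Deligne, Weil I (1.3)).
[cite: Milne2025, V §1 (p. 176)] -/
abbrev etaleEllAdicRat (Y : Scheme.{u}) (n : ℕ) : Type u :=
  ℚ_[ℓ] ⊗[ℤ_[ℓ]] etaleEllAdicTowerCohomology Y ℓ n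

/-- **The pull-back `f^* : Hⁿ(Y_ét, ℚ_ℓ) → Hⁿ(X_ét, ℚ_ℓ)`** (base change of the `ℤ_ℓ`-linear pull-back
on the tower). [cite: Milne2025, III Remark 1.6 (c)] -/
noncomputable def etaleEllAdicRatMap (n : ℕ) :
    etaleEllAdicRat ℓ Y n →ₗ[ℚ_[ℓ]] etaleEllAdicRat ℓ X n :=
  (etaleEllAdicTowerCohomologyMap f ℓ n).baseChange ℚ_[ℓ]

/-- `f^*(a ⊗ x) = a ⊗ f^* x`. [folklore] -/
@[simp]
theorem etaleEllAdicRatMap_tmul (n : ℕ) (a : ℚ_[ℓ]) (x : etaleEllAdicTowerCohomology Y ℓ n) :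
    etaleEllAdicRatMap f ℓ n (a ⊗ₜ x) = a ⊗ₜ etaleEllAdicTowerCohomologyMap f ℓ n x :=
  rfl

/-- `(g f)^* = f^* ∘ g^*` on the tower, as an identity of linear maps. [folklore] -/
theorem etaleEllAdicTowerCohomologyMap_comp' (n : ℕ) :
    etaleEllAdicTowerCohomologyMap (f ≫ g) ℓ n =
      etaleEllAdicTowerCohomologyMap f ℓ n ∘ₗ etaleEllAdicTowerCohomologyMap g ℓ n :=
  LinearMap.ext fun x => etaleEllAdicTowerCohomologyMap_comp f g ℓ n x

/-- `(𝟙)^* = id` on the tower, as an identity of linear maps. [folklore] -/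
theorem etaleEllAdicTowerCohomologyMap_id' (n : ℕ) :
    etaleEllAdicTowerCohomologyMap (𝟙 X) ℓ n = LinearMap.id :=
  LinearMap.ext fun x => etaleEllAdicTowerCohomologyMap_id ℓ n x

/-- **`(g f)^* = f^* ∘ g^*` on `Hⁿ(–_ét, ℚ_ℓ)`.** [cite: Milne2025, III Remark 1.6 (c)] -/
theorem etaleEllAdicRatMap_comp (n : ℕ) :
    etaleEllAdicRatMap (f ≫ g) ℓ n = etaleEllAdicRatMap f ℓ n ∘ₗ etaleEllAdicRatMap g ℓ n := by
  rw [etaleEllAdicRatMap, etaleEllAdicTowerCohomologyMap_comp', LinearMap.baseChange_comp]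
  rfl

/-- **`(𝟙)^* = id` on `Hⁿ(–_ét, ℚ_ℓ)`.** [cite: Milne2025, III Remark 1.6 (c)] -/
theorem etaleEllAdicRatMap_id (n : ℕ) : etaleEllAdicRatMap (𝟙 X) ℓ n = LinearMap.id := by
  rw [etaleEllAdicRatMap, etaleEllAdicTowerCohomologyMap_id', LinearMap.baseChange_id]

end Rat

/-! ### The cup product on `H•(X_ét, ℚ_ℓ)` -/

namespace etaleEllAdicRat

variable {X Y : Scheme.{u}} (ℓ : ℕ) [Fact ℓ.Prime]

/-- **The cup product on `H•(X_ét, ℚ_ℓ)`**: the `ℚ_ℓ`-bilinear extension of the cup product of the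
tower, `(a ⊗ x) ∪ (b ⊗ y) = ab ⊗ (x ∪ y)` (Milne V §1, p. 176: the pairings "tensored with `ℚ_l`").
[cite: Milne2025, V §1 (p. 176)] -/
noncomputable def cup (X : Scheme.{u}) {i j n : ℕ} (h : i + j = n) :
    etaleEllAdicRat ℓ X i →ₗ[ℚ_[ℓ]] etaleEllAdicRat ℓ X j →ₗ[ℚ_[ℓ]] etaleEllAdicRat ℓ X n :=
  baseChangeBilin ℚ_[ℓ] (ellAdicTowerCohomology.cupBilin h)

/-- `(a ⊗ x) ∪ (b ⊗ y) = ab ⊗ (x ∪ y)`. [folklore] -/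
@[simp]
theorem cup_tmul {i j n : ℕ} (h : i + j = n) (a b : ℚ_[ℓ]) (x : etaleEllAdicTowerCohomology X ℓ i)
    (y : etaleEllAdicTowerCohomology X ℓ j) :
    cup ℓ X h (a ⊗ₜ x) (b ⊗ₜ y) = (a * b) ⊗ₜ ellAdicTowerCohomology.cup h x y := by
  rw [cup, baseChangeBilin_tmul, ellAdicTowerCohomology.cupBilin_apply]

/-- **The unit `1 = 1 ⊗ 1 ∈ H⁰(X_ét, ℚ_ℓ)`.** [folklore] -/
noncomputable def one (X : Scheme.{u}) : etaleEllAdicRat ℓ X 0 :=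
  (1 : ℚ_[ℓ]) ⊗ₜ ellAdicTowerCohomology.one (isTerminalEtaleMkId X) ℓ

/-- `1 ∪ y = y`. [folklore] -/
theorem one_cup {j : ℕ} (y : etaleEllAdicRat ℓ X j) : cup ℓ X (zero_add j) (one ℓ X) y = y := by
  induction y using TensorProduct.induction_on with
  | zero => rw [map_zero]
  | tmul b y => rw [one, cup_tmul, one_mul, ellAdicTowerCohomology.one_cup]
  | add y y' hy hy' => rw [map_add, hy, hy']

/-- `x ∪ 1 = x`. [folklore] -/
theorem cup_one {i : ℕ} (x : etaleEllAdicRat ℓ X i) : cup ℓ X (add_zero i) x (one ℓ X) = x := by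
  induction x using TensorProduct.induction_on with
  | zero => rw [map_zero, LinearMap.zero_apply]
  | tmul a x => rw [one, cup_tmul, mul_one, ellAdicTowerCohomology.cup_one]
  | add x x' hx hx' => rw [map_add, LinearMap.add_apply, hx, hx']

/-- **Associativity** of the cup product on `H•(X_ét, ℚ_ℓ)`. [folklore] -/
theorem cup_assoc {i j l ij jl n : ℕ} (hij : i + j = ij) (hjl : j + l = jl) (h₁ : ij + l = n)
    (h₂ : i + jl = n) (x : etaleEllAdicRat ℓ X i) (y : etaleEllAdicRat ℓ X j)
    (z : etaleEllAdicRat ℓ X l) :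
    cup ℓ X h₁ (cup ℓ X hij x y) z = cup ℓ X h₂ x (cup ℓ X hjl y z) := by
  induction x using TensorProduct.induction_on with
  | zero => simp only [map_zero, LinearMap.zero_apply]
  | add x x' hx hx' => simp only [map_add, LinearMap.add_apply, hx, hx']
  | tmul a x =>
    induction y using TensorProduct.induction_on with
    | zero => simp only [map_zero, LinearMap.zero_apply]
    | add y y' hy hy' => simp only [map_add, LinearMap.add_apply, hy, hy']
    | tmul b y =>
      induction z using TensorProduct.induction_on with
      | zero => simp only [map_zero]
      | add z z' hz hz' => simp only [map_add, hz, hz']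
      | tmul c z =>
        rw [cup_tmul, cup_tmul, cup_tmul, cup_tmul, mul_assoc,
          ellAdicTowerCohomology.cup_assoc hij hjl h₁ h₂]

/-- **Pull-backs are multiplicative on `H•(–_ét, ℚ_ℓ)`**: `f^*(x ∪ y) = f^* x ∪ f^* y`.
[cite: Milne2025, V Proposition 1.16] -/
theorem map_cup (f : X ⟶ Y) {i j n : ℕ} (h : i + j = n) (x : etaleEllAdicRat ℓ Y i)
    (y : etaleEllAdicRat ℓ Y j) :
    etaleEllAdicRatMap f ℓ n (cup ℓ Y h x y) =
      cup ℓ X h (etaleEllAdicRatMap f ℓ i x) (etaleEllAdicRatMap f ℓ j y) := by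
  induction x using TensorProduct.induction_on with
  | zero => simp only [map_zero, LinearMap.zero_apply]
  | add x x' hx hx' => simp only [map_add, LinearMap.add_apply, hx, hx']
  | tmul a x =>
    induction y using TensorProduct.induction_on with
    | zero => simp only [map_zero]
    | add y y' hy hy' => simp only [map_add, hy, hy']
    | tmul b y =>
      rw [cup_tmul, etaleEllAdicRatMap_tmul, etaleEllAdicRatMap_tmul, etaleEllAdicRatMap_tmul,
        cup_tmul, etaleEllAdicTowerCohomologyMap_cup]

/-- **Pull-backs are unital**: `f^*(1) = 1`. [folklore] -/
theorem map_one (f : X ⟶ Y) : etaleEllAdicRatMap f ℓ 0 (one ℓ Y) = one ℓ X := by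
  rw [one, etaleEllAdicRatMap_tmul, etaleEllAdicTowerCohomologyMap_one]
  rfl

end etaleEllAdicRat

/-! ### The Galois representation on `Hⁿ(X_{k̄}, ℚ_ℓ)` and `F^* = ρ(F_geom)` -/

section RatGalois

variable {k : Type u} [Field k] (X : SchemeOver k) (ℓ : ℕ) [Fact ℓ.Prime] (n : ℕ)

/-- **The `ℚ_ℓ`-linear Galois representation `Hⁿ(X_{k̄}, ℚ_ℓ)`**: base change of
`geometricEllAdicTowerRep` (Deligne, Weil I (1.15)). [cite: Deligne1974, (1.15)] -/
noncomputable def geometricEllAdicRatRep :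
    Representation ℚ_[ℓ] (Field.absoluteGaloisGroup k) (etaleEllAdicRat ℓ (geometricFibre k X) n) :=
  (Module.End.baseChangeHom ℤ_[ℓ] ℚ_[ℓ] _).toMonoidHom.comp (geometricEllAdicTowerRep X ℓ n)

/-- `ρ_ℚ(g)` is the base change of `ρ(g)` (by `rfl`). [folklore] -/
theorem geometricEllAdicRatRep_apply (g : Field.absoluteGaloisGroup k) :
    geometricEllAdicRatRep X ℓ n g = (geometricEllAdicTowerRep X ℓ n g).baseChange ℚ_[ℓ] :=
  rfl

/-- `ρ_ℚ(g) = (1 × Spec g)^*` on `Hⁿ(X_{k̄}, ℚ_ℓ)`. [folklore] -/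
theorem geometricEllAdicRatRep_eq_map (g : Field.absoluteGaloisGroup k) :
    (geometricEllAdicRatRep X ℓ n g : _ →ₗ[ℚ_[ℓ]] _) =
      etaleEllAdicRatMap (geometricFibreMap X g) ℓ n :=
  rfl

/-- **The Galois action on `H•(X_{k̄}, ℚ_ℓ)` is multiplicative**: `ρ(g)(x ∪ y) = ρ(g)x ∪ ρ(g)y`.
[folklore] -/
theorem geometricEllAdicRatRep_cup (g : Field.absoluteGaloisGroup k) {i j m : ℕ} (h : i + j = m)
    (x : etaleEllAdicRat ℓ (geometricFibre k X) i) (y : etaleEllAdicRat ℓ (geometricFibre k X) j) :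
    geometricEllAdicRatRep X ℓ m g (etaleEllAdicRat.cup ℓ _ h x y) =
      etaleEllAdicRat.cup ℓ _ h (geometricEllAdicRatRep X ℓ i g x)
        (geometricEllAdicRatRep X ℓ j g y) := by
  rw [geometricEllAdicRatRep_eq_map, geometricEllAdicRatRep_eq_map, geometricEllAdicRatRep_eq_map]
  exact etaleEllAdicRat.map_cup ℓ _ h x y

/-- **The Galois action fixes `1`.** [folklore] -/
theorem geometricEllAdicRatRep_one (g : Field.absoluteGaloisGroup k) :
    geometricEllAdicRatRep X ℓ 0 g (etaleEllAdicRat.one ℓ (geometricFibre k X)) =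
      etaleEllAdicRat.one ℓ (geometricFibre k X) := by
  rw [geometricEllAdicRatRep_eq_map]
  exact etaleEllAdicRat.map_one ℓ _

variable {X} in
/-- **Pull-backs along `k`-morphisms are Galois equivariant on `Hⁿ(–, ℚ_ℓ)`** (the shape of the
axiom `GaloisWeilCohomology.pullback_ρ`). [folklore] -/
theorem geometricEllAdicRatRep_pullback {X' : SchemeOver k} (φ : X ⟶ X')
    (g : Field.absoluteGaloisGroup k) :
    geometricEllAdicRatRep X ℓ n g ∘ₗ etaleEllAdicRatMap (geometricFibreHom φ) ℓ n =
      etaleEllAdicRatMap (geometricFibreHom φ) ℓ n ∘ₗ geometricEllAdicRatRep X' ℓ n g := by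
  rw [geometricEllAdicRatRep_apply, geometricEllAdicRatRep_apply, etaleEllAdicRatMap,
    ← LinearMap.baseChange_comp, ← LinearMap.baseChange_comp]
  exact congrArg (LinearMap.baseChange ℚ_[ℓ])
    (LinearMap.ext fun y => geometricEllAdicTowerRep_pullback ℓ n φ g y)

variable [Finite k]

/-- **Deligne (1.15.1) with `ℚ_ℓ`-coefficients: `F^* = ρ(F_geom)` on `Hⁿ(X_{k̄}, ℚ_ℓ)`** for the
base-changed `k`-Frobenius `F = F_{X/k} × 1`. [cite: Deligne1974, (1.15.1)] -/
theorem etaleEllAdicRatMap_frobenius_eq_geomFrob :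
    etaleEllAdicRatMap (geometricFibreHom (frobeniusOver X)) ℓ n =
      geometricEllAdicRatRep X ℓ n (geomFrob k) := by
  rw [geometricEllAdicRatRep_apply, etaleEllAdicRatMap]
  exact congrArg (LinearMap.baseChange ℚ_[ℓ])
    (LinearMap.ext fun x => etaleEllAdicTowerCohomologyMap_frobenius_eq_geomFrob X ℓ n x)

/-- **The `q`-Frobenius of `X_{k̄}` acts trivially on `Hⁿ(X_{k̄}, ℚ_ℓ)`.** [cite: Milne2025, VI Lemma 13.2] -/
theorem etaleEllAdicRatMap_geometricFibreFrobenius :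
    etaleEllAdicRatMap (geometricFibreFrobenius X) ℓ n = LinearMap.id := by
  rw [etaleEllAdicRatMap, ← LinearMap.baseChange_id]
  exact congrArg (LinearMap.baseChange ℚ_[ℓ])
    (LinearMap.ext fun x => etaleEllAdicTowerCohomologyMap_geometricFibreFrobenius X ℓ n x)

end RatGalois

end Literature.AlgebraicGeometry.Motives
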